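import Summits.BirchSwinnertonDyer.BirchSwinnertonDyer.Theorems.PrintCf2DisegniPairTwoTameBranchCm7Currency
import HarnessLib

/-!
# Road (C) `disegni-pair-two` on crux stmt-BirchSwinnertonDyer-20368 — the ODD-class defect keys close by LINEAR ARITHMETIC from the
# (Δ1′) descent law in `cm7`-currency (both signs of the twist parameter)

Cell `bsd-print-cf2`, width seat `bsd-line-cf2-p1-w8` g24; odd-class twin of `padicValRat_shaAn_eq_of_descentLaw_cm7[_neg]`
(`PrintCf2DisegniPairTwoTamePeriodTransport[Neg]Cm7.lean`; memo `Cruxes/SplitBadTwoRankOneOfFacts/PERIOD-CANCELS-w8g24.md` §9).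
`--supports stmt-BirchSwinnertonDyer-20368` (helper). THEOREMS ONLY (no `def`, no named fact, no `sorry`); conditional on every displayed
hypothesis — in particular the (Δ1′) law is an EXPLICIT HYPOTHESIS `hΔ1` (the road's research stub), the anchor print
`OptimalCurveManinCertificate cm7`, modularity and the PRINT stub `ChiLineGrossZagierClauses`. BSD is not proved here; no summit statement is
claimed; 20368 is not closed here.

* ★★★ `padicValRat_shaAn_eq_of_descentLaw_cm7_chi4[_neg]`, `padicValRat_shaAn_eq_of_descentLaw_cm7_chi8'[_neg]` — in the frame of
  `defectKey_chi4_cm7_currency[_neg]` / `defectKey_chi8'_cm7_currency[_neg]`: (Δ1′) `v₂(D_G) − v₂(h₂) = s₂ + v₂(Tam W) − 2v₂(#tors) − 2`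
  ⇒ `shaAn W = q ∈ ℚˣ ∧ v₂(q) = s₂` (`linear_combination`).

References: D. Disegni, Compos. Math. 153 (2017) Thm. B [Disegni2017]; B. Mazur, J. Tate, J. Teitelbaum, Invent. Math. 84 (1986) §I.8, §I.13
[MazurTateTeitelbaum1986Invent]; B. Perrin-Riou, Invent. Math. 89 (1987) §1 [PerrinRiou1987].
-/

set_option autoImplicit false
set_option linter.dupNamespace false

noncomputable section

open scoped Classical MatrixGroups ModularForm NumberField NumberTheorySymbols

open CongruenceSubgroup NumberField IsDedekindDomain WeierstrassCurve WeierstrassCurve.Affine.Point PowerSeries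
  Literature.NumberTheory.EllipticCurves Literature.NumberTheory.EllipticCurves.ModularForms
  Literature.NumberTheory.EllipticCurves.Disegni2017 Literature.NumberTheory.GaloisRepresentations
  Literature.NumberTheory.EllipticCurves.GreenbergVatsal2000 Summit.BirchSwinnertonDyer.Rank1Residual.AdditivePotMult

namespace Summit.BirchSwinnertonDyer.BirchSwinnertonDyer.Theorems.PrintCf2.DisegniPairTwo

variable (ι : PadicAlgCl 2 ≃+* ℂ) (K : Type) [Field K] [NumberField K] [IsGalois ℚ K]

/-- ★★★ **The `χ₋₄∘N`-class defect key CLOSES by linear arithmetic from the descent law in `cm7`-currency (`d > 0`).** In the frame of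
`defectKey_chi4_cm7_currency`, suppose the (Δ1′) DESCENT LAW for `W` read on the class's functional `D_G` of the tame branch of the level-`49` form:
`v₂(D_G) − v₂(h₂) = s₂ + v₂(Tam W) − 2·v₂(#W(ℚ)_tors) − 2` (`s₂ ∈ ℤ`; in the road `s₂ = v₂(#Ш(W)[2^∞])`; the `−2` is `v₂(log₂ γ)`-bookkeeping,
`γ = 5`). Then `shaAn W = q ∈ ℚˣ` with `v₂(q) = s₂` — the class's DK with NO class constant. (Δ1′) is the road's research stub; nothing here
asserts it. [cite: Disegni2017, Theorem B] [cite: MazurTateTeitelbaum1986Invent, §I.8 and §I.13] [cite: PerrinRiou1987, §1] -/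
theorem padicValRat_shaAn_eq_of_descentLaw_cm7_chi4 (hGZ73 : GrossZagier1986_thm_I_7_3) (h2 : Module.finrank ℚ K = 2)
    (hsplit : ((Ideal.span {(2 : ℤ)}).primesOver (𝓞 K)).ncard = 2)
    (𝔭 𝔭' : HeightOneSpectrum (𝓞 K)) (h𝔭 : ((2 : ℕ) : 𝓞 K) ∈ 𝔭.asIdeal)
    (h𝔭' : ((2 : ℕ) : 𝓞 K) ∈ 𝔭'.asIdeal)
    (κ : DirichletCharacter ℂ (NumberField.discr K).natAbs)
    (hκ : ∀ ℓ : ℕ, ℓ.Prime → ℓ ≠ 2 → κ ℓ = (jacobiSym (NumberField.discr K) ℓ : ℂ))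
    (hκ2 : κ 2 = if NumberField.discr K % 8 = 1 then 1 else if NumberField.discr K % 8 = 5 then -1 else 0)
    (hd : Nat.Coprime 2 (NumberField.discr K).natAbs)
    -- the base `cm7`: anchor print, newform, and the twist parameter `d`
    [cm7.IsGloballyMinimal] [NeZero (cm7.conductorNorm ℤ)] (hM : OptimalCurveManinCertificate cm7)
    {fE : CuspForm (Gamma0 (cm7.conductorNorm ℤ)) 2} (hfE : IsNewformOf cm7 fE)
    (hmodf : exists_isNewformOf) {d : ℤ} [NeZero d.natAbs] (hd0 : 0 < d) (hd4 : d % 4 = 1) (hsq : Squarefree d)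
    (hcop : IsCoprime d (cm7.conductorNorm ℤ : ℤ)) (h7 : ¬ (7 : ℤ) ∣ d) {χJ : MulChar (ZMod d.natAbs) ℤ}
    (hχJ : ∀ a : ZMod d.natAbs, χJ a = J((a.val : ℤ) | d.natAbs))
    -- the good pair over `V = C₀ • cm7^{(d)}`
    (V V' : WeierstrassCurve ℚ) [V.IsElliptic] [V.IsGloballyMinimal] [V'.IsElliptic] [V'.IsGloballyMinimal]
    [NeZero (V.conductorNorm ℤ)] {C₀ : VariableChange ℚ} (hV : C₀ • cm7.quadraticTwist (d : ℚ) = V)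
    (hordV' : IsOrdinaryAt V' 2) (hap : V'.frobeniusTrace 2 = V.frobeniusTrace 2)
    {N' : ℕ} [NeZero N'] {f : CuspForm (Gamma0 (V.conductorNorm ℤ)) 2}
    {f' : CuspForm (Gamma0 N') 2} (hfV : IsNewformOf V f) (hfV' : IsNewformOf V' f')
    (hV' : ∀ n : ℕ, cuspCoeff f' n = κ (n : ZMod _) * cuspCoeff f n)
    (h0 : PowerSeries.constantCoeff (padicLFunctionMinusBranch f (unitRoot V 2 : ℚ_[2]) 1) = 0)
    (hmod : hasEntireLFunction_rat) {M M' : ℕ} [NeZero M] [NeZero M']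
    {g : CuspForm (Gamma0 M) 2} {g' : CuspForm (Gamma0 M') 2}
    (W W' : WeierstrassCurve ℚ) [W.IsElliptic] [W.IsGloballyMinimal] [W'.IsElliptic]
    (hg : IsNewformOf W g) (hg' : IsNewformOf W' g')
    (hgε : ∀ m : ℕ, cuspCoeff g m = (ZMod.χ₄.ringHomComp (Int.castRingHom ℂ)) m * cuspCoeff f m)
    (hg'ε : ∀ m : ℕ, cuspCoeff g' m = (ZMod.χ₄.ringHomComp (Int.castRingHom ℂ)) m * cuspCoeff f' m)
    (hr : W.analyticRank = 1) (hrk : W.mordellWeilRank = 1) (hL' : W'.entireLFunction 1 ≠ 0)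
    {H : Type} [Field H] [NumberField H] [Algebra K H] (hKH : Module.finrank K H = 2) {t : H}
    (htK : t ∉ Set.range (algebraMap K H)) (ht2 : t ^ 2 = algebraMap ℚ H (-1))
    (G : Subgroup (H ≃ₐ[ℚ] H)) (χ : G →* ℂˣ) (s : G → ℤ) (hs : ∀ σ, ((χ σ : ℂˣ) : ℂ) = (s σ : ℂ))
    (τ : H ≃ₐ[ℚ] H) (hτG : τ ∈ G) (hsτ : s ⟨τ, hτG⟩ = -1)
    (hτK : ∀ a : K, τ (algebraMap K H a) = algebraMap K H a) (hτt : τ t = -t)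
    {u : K} {e : ℚ} (hu : u ∉ Set.range (algebraMap ℚ K)) (hue : u ^ 2 = algebraMap ℚ K e)
    (c : K ≃ₐ[ℚ] K) (hcu : c u = -u)
    [(V.quadraticTwist (-1)).IsElliptic] {C : VariableChange ℚ} (hC : C • W = V.quadraticTwist (-1))
    {P : (V.quadraticTwist (-1)).toAffine.Point}
    (hgen : ∀ R : (V.quadraticTwist (-1)).toAffine.Point,
      ∃ (k : ℤ) (T : (V.quadraticTwist (-1)).toAffine.Point), IsOfFinAddOrder T ∧ R = k • P + T)
    (htors : ∀ Q : ((V.quadraticTwist (-1)).quadraticTwist e).toAffine.Point, IsOfFinAddOrder Q)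
    (DH : PAdicHeightDataK V 2 H)
    (hDH : ∀ (σ : G) (a b : (V.baseChange H).toAffine.Point),
      DH.pairing (pointGalHom V H σ.1 a) (pointGalHom V H σ.1 b) = DH.pairing a b)
    {h₂ : ℚ_[2]}
    (hpin : DH.pairing
      (twistPointEquivOver V (not_mem_range_rat_of_not_mem_range htK) ht2
        (QuadraticDescent.incl H (V.quadraticTwist (-1)) P))
      (twistPointEquivOver V (not_mem_range_rat_of_not_mem_range htK) ht2
        (QuadraticDescent.incl H (V.quadraticTwist (-1)) P)) = h₂)
    (hGZ : ChiLineGrossZagierClauses ι K V H f (ι (((unitRoot V 2 : ℚ_[2]) : PadicAlgCl 2)))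
      (baseChangeDirichlet K (ZMod.χ₄.ringHomComp (Int.castRingHom ℂ))) 𝔭 𝔭' G χ DH)
    (hh₂ : h₂ ≠ 0)
    -- the (Δ1′) descent law in `cm7`-currency (research stub of the road; an explicit hypothesis here)
    (s₂ : ℤ)
    (hΔ1 : (PowerSeries.coeff 1 (padicLFunctionTameMinusBranch fE d.natAbs (unitRoot cm7 2 : ℚ_[2])
            ((χJ.ringHomComp (Int.castRingHom ℚ)).ringHomComp (Rat.castHom ℚ_[2])) 1)).valuation - h₂.valuation =
      s₂ + (padicValNat 2 W.tamagawaProduct : ℤ) - 2 * (padicValNat 2 W.torsionOrder : ℤ) - 2) :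
    ∃ q : ℚ, shaAn W = (q : ℂ) ∧ q ≠ 0 ∧ padicValRat 2 q = s₂ := by
  obtain ⟨-, q, hq, hq0, hv⟩ := defectKey_chi4_cm7_currency ι K hGZ73 h2 hsplit 𝔭 𝔭' h𝔭 h𝔭' κ hκ hκ2 hd hM hfE
    hmodf hd0 hd4 hsq hcop h7 hχJ V V' hV hordV' hap hfV hfV' hV' h0 hmod W W' hg hg' hgε hg'ε hr hrk hL' hKH htK ht2 G χ s
    hs τ hτG hsτ hτK hτt hu hue c hcu hC hgen htors DH hDH hpin hGZ hh₂
  exact ⟨q, hq, hq0, by linear_combination hv + hΔ1⟩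

/-- ★★★ **The `χ₋₄∘N`-class defect key CLOSES by linear arithmetic from the descent law in `cm7`-currency (`d < 0`).** In the frame of
`defectKey_chi4_cm7_currency_neg`, suppose the (Δ1′) DESCENT LAW for `W` read on the class's functional `D_G` of the tame branch of the level-`49` form:
`v₂(D_G) − v₂(h₂) = s₂ + v₂(Tam W) − 2·v₂(#W(ℚ)_tors) − 2` (`s₂ ∈ ℤ`; in the road `s₂ = v₂(#Ш(W)[2^∞])`; the `−2` is `v₂(log₂ γ)`-bookkeeping,
`γ = 5`). Then `shaAn W = q ∈ ℚˣ` with `v₂(q) = s₂` — the class's DK with NO class constant. (Δ1′) is the road's research stub; nothing here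
asserts it. [cite: Disegni2017, Theorem B] [cite: MazurTateTeitelbaum1986Invent, §I.8 and §I.13] [cite: PerrinRiou1987, §1] -/
theorem padicValRat_shaAn_eq_of_descentLaw_cm7_chi4_neg (hGZ73 : GrossZagier1986_thm_I_7_3) (h2 : Module.finrank ℚ K = 2)
    (hsplit : ((Ideal.span {(2 : ℤ)}).primesOver (𝓞 K)).ncard = 2)
    (𝔭 𝔭' : HeightOneSpectrum (𝓞 K)) (h𝔭 : ((2 : ℕ) : 𝓞 K) ∈ 𝔭.asIdeal)
    (h𝔭' : ((2 : ℕ) : 𝓞 K) ∈ 𝔭'.asIdeal)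
    (κ : DirichletCharacter ℂ (NumberField.discr K).natAbs)
    (hκ : ∀ ℓ : ℕ, ℓ.Prime → ℓ ≠ 2 → κ ℓ = (jacobiSym (NumberField.discr K) ℓ : ℂ))
    (hκ2 : κ 2 = if NumberField.discr K % 8 = 1 then 1 else if NumberField.discr K % 8 = 5 then -1 else 0)
    (hd : Nat.Coprime 2 (NumberField.discr K).natAbs)
    -- the base `cm7`: anchor print, newform, and the twist parameter `d`
    [cm7.IsGloballyMinimal] [NeZero (cm7.conductorNorm ℤ)] (hM : OptimalCurveManinCertificate cm7)
    {fE : CuspForm (Gamma0 (cm7.conductorNorm ℤ)) 2} (hfE : IsNewformOf cm7 fE)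
    (hmodf : exists_isNewformOf) {d : ℤ} [NeZero d.natAbs] (hd0 : d < 0) (hd4 : d % 4 = 1) (hsq : Squarefree d)
    (hcop : IsCoprime d (cm7.conductorNorm ℤ : ℤ)) (h7 : ¬ (7 : ℤ) ∣ d) {χJ : MulChar (ZMod d.natAbs) ℤ}
    (hχJ : ∀ a : ZMod d.natAbs, χJ a = J((a.val : ℤ) | d.natAbs))
    -- the good pair over `V = C₀ • cm7^{(d)}`
    (V V' : WeierstrassCurve ℚ) [V.IsElliptic] [V.IsGloballyMinimal] [V'.IsElliptic] [V'.IsGloballyMinimal]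
    [NeZero (V.conductorNorm ℤ)] {C₀ : VariableChange ℚ} (hV : C₀ • cm7.quadraticTwist (d : ℚ) = V)
    (hordV' : IsOrdinaryAt V' 2) (hap : V'.frobeniusTrace 2 = V.frobeniusTrace 2)
    {N' : ℕ} [NeZero N'] {f : CuspForm (Gamma0 (V.conductorNorm ℤ)) 2}
    {f' : CuspForm (Gamma0 N') 2} (hfV : IsNewformOf V f) (hfV' : IsNewformOf V' f')
    (hV' : ∀ n : ℕ, cuspCoeff f' n = κ (n : ZMod _) * cuspCoeff f n)
    (h0 : PowerSeries.constantCoeff (padicLFunctionMinusBranch f (unitRoot V 2 : ℚ_[2]) 1) = 0)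
    (hmod : hasEntireLFunction_rat) {M M' : ℕ} [NeZero M] [NeZero M']
    {g : CuspForm (Gamma0 M) 2} {g' : CuspForm (Gamma0 M') 2}
    (W W' : WeierstrassCurve ℚ) [W.IsElliptic] [W.IsGloballyMinimal] [W'.IsElliptic]
    (hg : IsNewformOf W g) (hg' : IsNewformOf W' g')
    (hgε : ∀ m : ℕ, cuspCoeff g m = (ZMod.χ₄.ringHomComp (Int.castRingHom ℂ)) m * cuspCoeff f m)
    (hg'ε : ∀ m : ℕ, cuspCoeff g' m = (ZMod.χ₄.ringHomComp (Int.castRingHom ℂ)) m * cuspCoeff f' m)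
    (hr : W.analyticRank = 1) (hrk : W.mordellWeilRank = 1) (hL' : W'.entireLFunction 1 ≠ 0)
    {H : Type} [Field H] [NumberField H] [Algebra K H] (hKH : Module.finrank K H = 2) {t : H}
    (htK : t ∉ Set.range (algebraMap K H)) (ht2 : t ^ 2 = algebraMap ℚ H (-1))
    (G : Subgroup (H ≃ₐ[ℚ] H)) (χ : G →* ℂˣ) (s : G → ℤ) (hs : ∀ σ, ((χ σ : ℂˣ) : ℂ) = (s σ : ℂ))
    (τ : H ≃ₐ[ℚ] H) (hτG : τ ∈ G) (hsτ : s ⟨τ, hτG⟩ = -1)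
    (hτK : ∀ a : K, τ (algebraMap K H a) = algebraMap K H a) (hτt : τ t = -t)
    {u : K} {e : ℚ} (hu : u ∉ Set.range (algebraMap ℚ K)) (hue : u ^ 2 = algebraMap ℚ K e)
    (c : K ≃ₐ[ℚ] K) (hcu : c u = -u)
    [(V.quadraticTwist (-1)).IsElliptic] {C : VariableChange ℚ} (hC : C • W = V.quadraticTwist (-1))
    {P : (V.quadraticTwist (-1)).toAffine.Point}
    (hgen : ∀ R : (V.quadraticTwist (-1)).toAffine.Point,
      ∃ (k : ℤ) (T : (V.quadraticTwist (-1)).toAffine.Point), IsOfFinAddOrder T ∧ R = k • P + T)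
    (htors : ∀ Q : ((V.quadraticTwist (-1)).quadraticTwist e).toAffine.Point, IsOfFinAddOrder Q)
    (DH : PAdicHeightDataK V 2 H)
    (hDH : ∀ (σ : G) (a b : (V.baseChange H).toAffine.Point),
      DH.pairing (pointGalHom V H σ.1 a) (pointGalHom V H σ.1 b) = DH.pairing a b)
    {h₂ : ℚ_[2]}
    (hpin : DH.pairing
      (twistPointEquivOver V (not_mem_range_rat_of_not_mem_range htK) ht2
        (QuadraticDescent.incl H (V.quadraticTwist (-1)) P))
      (twistPointEquivOver V (not_mem_range_rat_of_not_mem_range htK) ht2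
        (QuadraticDescent.incl H (V.quadraticTwist (-1)) P)) = h₂)
    (hGZ : ChiLineGrossZagierClauses ι K V H f (ι (((unitRoot V 2 : ℚ_[2]) : PadicAlgCl 2)))
      (baseChangeDirichlet K (ZMod.χ₄.ringHomComp (Int.castRingHom ℂ))) 𝔭 𝔭' G χ DH)
    (hh₂ : h₂ ≠ 0)
    -- the (Δ1′) descent law in `cm7`-currency (research stub of the road; an explicit hypothesis here)
    (s₂ : ℤ)
    (hΔ1 : (PowerSeries.coeff 1 (padicLFunctionTameBranch fE d.natAbs (unitRoot cm7 2 : ℚ_[2])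
            ((χJ.ringHomComp (Int.castRingHom ℚ)).ringHomComp (Rat.castHom ℚ_[2])) 1)).valuation - h₂.valuation =
      s₂ + (padicValNat 2 W.tamagawaProduct : ℤ) - 2 * (padicValNat 2 W.torsionOrder : ℤ) - 2) :
    ∃ q : ℚ, shaAn W = (q : ℂ) ∧ q ≠ 0 ∧ padicValRat 2 q = s₂ := by
  obtain ⟨-, q, hq, hq0, hv⟩ := defectKey_chi4_cm7_currency_neg ι K hGZ73 h2 hsplit 𝔭 𝔭' h𝔭 h𝔭' κ hκ hκ2 hd hM hfE
    hmodf hd0 hd4 hsq hcop h7 hχJ V V' hV hordV' hap hfV hfV' hV' h0 hmod W W' hg hg' hgε hg'ε hr hrk hL' hKH htK ht2 G χ s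
    hs τ hτG hsτ hτK hτt hu hue c hcu hC hgen htors DH hDH hpin hGZ hh₂
  exact ⟨q, hq, hq0, by linear_combination hv + hΔ1⟩

/-- ★★★ **The `χ₋₈∘N`-class defect key CLOSES by linear arithmetic from the descent law in `cm7`-currency (`d > 0`).** In the frame of
`defectKey_chi8'_cm7_currency`, suppose the (Δ1′) DESCENT LAW for `W` read on the class's functional `D_G` of the tame branch of the level-`49` form:
`v₂(D_G) − v₂(h₂) = s₂ + v₂(Tam W) − 2·v₂(#W(ℚ)_tors) − 2` (`s₂ ∈ ℤ`; in the road `s₂ = v₂(#Ш(W)[2^∞])`; the `−2` is `v₂(log₂ γ)`-bookkeeping,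
`γ = 5`). Then `shaAn W = q ∈ ℚˣ` with `v₂(q) = s₂` — the class's DK with NO class constant. (Δ1′) is the road's research stub; nothing here
asserts it. [cite: Disegni2017, Theorem B] [cite: MazurTateTeitelbaum1986Invent, §I.8 and §I.13] [cite: PerrinRiou1987, §1] -/
theorem padicValRat_shaAn_eq_of_descentLaw_cm7_chi8' (hGZ73 : GrossZagier1986_thm_I_7_3) (h2 : Module.finrank ℚ K = 2)
    (hsplit : ((Ideal.span {(2 : ℤ)}).primesOver (𝓞 K)).ncard = 2)
    (𝔭 𝔭' : HeightOneSpectrum (𝓞 K)) (h𝔭 : ((2 : ℕ) : 𝓞 K) ∈ 𝔭.asIdeal)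
    (h𝔭' : ((2 : ℕ) : 𝓞 K) ∈ 𝔭'.asIdeal)
    (κ : DirichletCharacter ℂ (NumberField.discr K).natAbs)
    (hκ : ∀ ℓ : ℕ, ℓ.Prime → ℓ ≠ 2 → κ ℓ = (jacobiSym (NumberField.discr K) ℓ : ℂ))
    (hκ2 : κ 2 = if NumberField.discr K % 8 = 1 then 1 else if NumberField.discr K % 8 = 5 then -1 else 0)
    (hd : Nat.Coprime 2 (NumberField.discr K).natAbs)
    -- the base `cm7`: anchor print, newform, and the twist parameter `d`
    [cm7.IsGloballyMinimal] [NeZero (cm7.conductorNorm ℤ)] (hM : OptimalCurveManinCertificate cm7)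
    {fE : CuspForm (Gamma0 (cm7.conductorNorm ℤ)) 2} (hfE : IsNewformOf cm7 fE)
    (hmodf : exists_isNewformOf) {d : ℤ} [NeZero d.natAbs] (hd0 : 0 < d) (hd4 : d % 4 = 1) (hsq : Squarefree d)
    (hcop : IsCoprime d (cm7.conductorNorm ℤ : ℤ)) (h7 : ¬ (7 : ℤ) ∣ d) {χJ : MulChar (ZMod d.natAbs) ℤ}
    (hχJ : ∀ a : ZMod d.natAbs, χJ a = J((a.val : ℤ) | d.natAbs))
    -- the good pair over `V = C₀ • cm7^{(d)}`
    (V V' : WeierstrassCurve ℚ) [V.IsElliptic] [V.IsGloballyMinimal] [V'.IsElliptic] [V'.IsGloballyMinimal]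
    [NeZero (V.conductorNorm ℤ)] {C₀ : VariableChange ℚ} (hV : C₀ • cm7.quadraticTwist (d : ℚ) = V)
    (hordV' : IsOrdinaryAt V' 2) (hap : V'.frobeniusTrace 2 = V.frobeniusTrace 2)
    {N' : ℕ} [NeZero N'] {f : CuspForm (Gamma0 (V.conductorNorm ℤ)) 2}
    {f' : CuspForm (Gamma0 N') 2} (hfV : IsNewformOf V f) (hfV' : IsNewformOf V' f')
    (hV' : ∀ n : ℕ, cuspCoeff f' n = κ (n : ZMod _) * cuspCoeff f n)
    (h0 : HasSum (fun k : ℕ ↦ PowerSeries.coeff k (padicLFunctionMinusBranch f (unitRoot V 2 : ℚ_[2]) 1) *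
      (-2 : ℚ_[2]) ^ k) 0)
    (hmod : hasEntireLFunction_rat) {M M' : ℕ} [NeZero M] [NeZero M']
    {g : CuspForm (Gamma0 M) 2} {g' : CuspForm (Gamma0 M') 2}
    (W W' : WeierstrassCurve ℚ) [W.IsElliptic] [W.IsGloballyMinimal] [W'.IsElliptic]
    (hg : IsNewformOf W g) (hg' : IsNewformOf W' g')
    (hgε : ∀ m : ℕ, cuspCoeff g m = (ZMod.χ₈'.ringHomComp (Int.castRingHom ℂ)) m * cuspCoeff f m)
    (hg'ε : ∀ m : ℕ, cuspCoeff g' m = (ZMod.χ₈'.ringHomComp (Int.castRingHom ℂ)) m * cuspCoeff f' m)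
    (hr : W.analyticRank = 1) (hrk : W.mordellWeilRank = 1) (hL' : W'.entireLFunction 1 ≠ 0)
    {H : Type} [Field H] [NumberField H] [Algebra K H] (hKH : Module.finrank K H = 2) {t : H}
    (htK : t ∉ Set.range (algebraMap K H)) (ht2 : t ^ 2 = algebraMap ℚ H (-2))
    (G : Subgroup (H ≃ₐ[ℚ] H)) (χ : G →* ℂˣ) (s : G → ℤ) (hs : ∀ σ, ((χ σ : ℂˣ) : ℂ) = (s σ : ℂ))
    (τ : H ≃ₐ[ℚ] H) (hτG : τ ∈ G) (hsτ : s ⟨τ, hτG⟩ = -1)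
    (hτK : ∀ a : K, τ (algebraMap K H a) = algebraMap K H a) (hτt : τ t = -t)
    {u : K} {e : ℚ} (hu : u ∉ Set.range (algebraMap ℚ K)) (hue : u ^ 2 = algebraMap ℚ K e)
    (c : K ≃ₐ[ℚ] K) (hcu : c u = -u)
    [(V.quadraticTwist (-2)).IsElliptic] {C : VariableChange ℚ} (hC : C • W = V.quadraticTwist (-2))
    {P : (V.quadraticTwist (-2)).toAffine.Point}
    (hgen : ∀ R : (V.quadraticTwist (-2)).toAffine.Point,
      ∃ (k : ℤ) (T : (V.quadraticTwist (-2)).toAffine.Point), IsOfFinAddOrder T ∧ R = k • P + T)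
    (htors : ∀ Q : ((V.quadraticTwist (-2)).quadraticTwist e).toAffine.Point, IsOfFinAddOrder Q)
    (DH : PAdicHeightDataK V 2 H)
    (hDH : ∀ (σ : G) (a b : (V.baseChange H).toAffine.Point),
      DH.pairing (pointGalHom V H σ.1 a) (pointGalHom V H σ.1 b) = DH.pairing a b)
    {h₂ : ℚ_[2]}
    (hpin : DH.pairing
      (twistPointEquivOver V (not_mem_range_rat_of_not_mem_range htK) ht2
        (QuadraticDescent.incl H (V.quadraticTwist (-2)) P))
      (twistPointEquivOver V (not_mem_range_rat_of_not_mem_range htK) ht2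
        (QuadraticDescent.incl H (V.quadraticTwist (-2)) P)) = h₂)
    (hGZ : ChiLineGrossZagierClauses ι K V H f (ι (((unitRoot V 2 : ℚ_[2]) : PadicAlgCl 2)))
      (baseChangeDirichlet K (ZMod.χ₈'.ringHomComp (Int.castRingHom ℂ))) 𝔭 𝔭' G χ DH)
    (hh₂ : h₂ ≠ 0)
    -- the (Δ1′) descent law in `cm7`-currency (research stub of the road; an explicit hypothesis here)
    (s₂ : ℤ)
    (hΔ1 : (∑' k : ℕ, PowerSeries.coeff k (padicLFunctionTameMinusBranch fE d.natAbs (unitRoot cm7 2 : ℚ_[2])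
            ((χJ.ringHomComp (Int.castRingHom ℚ)).ringHomComp (Rat.castHom ℚ_[2])) 1) * (k : ℚ_[2]) * (-2) ^ (k - 1)).valuation - h₂.valuation =
      s₂ + (padicValNat 2 W.tamagawaProduct : ℤ) - 2 * (padicValNat 2 W.torsionOrder : ℤ) - 2) :
    ∃ q : ℚ, shaAn W = (q : ℂ) ∧ q ≠ 0 ∧ padicValRat 2 q = s₂ := by
  obtain ⟨-, q, hq, hq0, hv⟩ := defectKey_chi8'_cm7_currency ι K hGZ73 h2 hsplit 𝔭 𝔭' h𝔭 h𝔭' κ hκ hκ2 hd hM hfE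
    hmodf hd0 hd4 hsq hcop h7 hχJ V V' hV hordV' hap hfV hfV' hV' h0 hmod W W' hg hg' hgε hg'ε hr hrk hL' hKH htK ht2 G χ s
    hs τ hτG hsτ hτK hτt hu hue c hcu hC hgen htors DH hDH hpin hGZ hh₂
  exact ⟨q, hq, hq0, by linear_combination hv + hΔ1⟩

/-- ★★★ **The `χ₋₈∘N`-class defect key CLOSES by linear arithmetic from the descent law in `cm7`-currency (`d < 0`).** In the frame of
`defectKey_chi8'_cm7_currency_neg`, suppose the (Δ1′) DESCENT LAW for `W` read on the class's functional `D_G` of the tame branch of the level-`49` form: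
`v₂(D_G) − v₂(h₂) = s₂ + v₂(Tam W) − 2·v₂(#W(ℚ)_tors) − 2` (`s₂ ∈ ℤ`; in the road `s₂ = v₂(#Ш(W)[2^∞])`; the `−2` is `v₂(log₂ γ)`-bookkeeping,
`γ = 5`). Then `shaAn W = q ∈ ℚˣ` with `v₂(q) = s₂` — the class's DK with NO class constant. (Δ1′) is the road's research stub; nothing here
asserts it. [cite: Disegni2017, Theorem B] [cite: MazurTateTeitelbaum1986Invent, §I.8 and §I.13] [cite: PerrinRiou1987, §1] -/
theorem padicValRat_shaAn_eq_of_descentLaw_cm7_chi8'_neg (hGZ73 : GrossZagier1986_thm_I_7_3) (h2 : Module.finrank ℚ K = 2)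
    (hsplit : ((Ideal.span {(2 : ℤ)}).primesOver (𝓞 K)).ncard = 2)
    (𝔭 𝔭' : HeightOneSpectrum (𝓞 K)) (h𝔭 : ((2 : ℕ) : 𝓞 K) ∈ 𝔭.asIdeal)
    (h𝔭' : ((2 : ℕ) : 𝓞 K) ∈ 𝔭'.asIdeal)
    (κ : DirichletCharacter ℂ (NumberField.discr K).natAbs)
    (hκ : ∀ ℓ : ℕ, ℓ.Prime → ℓ ≠ 2 → κ ℓ = (jacobiSym (NumberField.discr K) ℓ : ℂ))
    (hκ2 : κ 2 = if NumberField.discr K % 8 = 1 then 1 else if NumberField.discr K % 8 = 5 then -1 else 0)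
    (hd : Nat.Coprime 2 (NumberField.discr K).natAbs)
    -- the base `cm7`: anchor print, newform, and the twist parameter `d`
    [cm7.IsGloballyMinimal] [NeZero (cm7.conductorNorm ℤ)] (hM : OptimalCurveManinCertificate cm7)
    {fE : CuspForm (Gamma0 (cm7.conductorNorm ℤ)) 2} (hfE : IsNewformOf cm7 fE)
    (hmodf : exists_isNewformOf) {d : ℤ} [NeZero d.natAbs] (hd0 : d < 0) (hd4 : d % 4 = 1) (hsq : Squarefree d)
    (hcop : IsCoprime d (cm7.conductorNorm ℤ : ℤ)) (h7 : ¬ (7 : ℤ) ∣ d) {χJ : MulChar (ZMod d.natAbs) ℤ}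
    (hχJ : ∀ a : ZMod d.natAbs, χJ a = J((a.val : ℤ) | d.natAbs))
    -- the good pair over `V = C₀ • cm7^{(d)}`
    (V V' : WeierstrassCurve ℚ) [V.IsElliptic] [V.IsGloballyMinimal] [V'.IsElliptic] [V'.IsGloballyMinimal]
    [NeZero (V.conductorNorm ℤ)] {C₀ : VariableChange ℚ} (hV : C₀ • cm7.quadraticTwist (d : ℚ) = V)
    (hordV' : IsOrdinaryAt V' 2) (hap : V'.frobeniusTrace 2 = V.frobeniusTrace 2)
    {N' : ℕ} [NeZero N'] {f : CuspForm (Gamma0 (V.conductorNorm ℤ)) 2}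
    {f' : CuspForm (Gamma0 N') 2} (hfV : IsNewformOf V f) (hfV' : IsNewformOf V' f')
    (hV' : ∀ n : ℕ, cuspCoeff f' n = κ (n : ZMod _) * cuspCoeff f n)
    (h0 : HasSum (fun k : ℕ ↦ PowerSeries.coeff k (padicLFunctionMinusBranch f (unitRoot V 2 : ℚ_[2]) 1) *
      (-2 : ℚ_[2]) ^ k) 0)
    (hmod : hasEntireLFunction_rat) {M M' : ℕ} [NeZero M] [NeZero M']
    {g : CuspForm (Gamma0 M) 2} {g' : CuspForm (Gamma0 M') 2}
    (W W' : WeierstrassCurve ℚ) [W.IsElliptic] [W.IsGloballyMinimal] [W'.IsElliptic]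
    (hg : IsNewformOf W g) (hg' : IsNewformOf W' g')
    (hgε : ∀ m : ℕ, cuspCoeff g m = (ZMod.χ₈'.ringHomComp (Int.castRingHom ℂ)) m * cuspCoeff f m)
    (hg'ε : ∀ m : ℕ, cuspCoeff g' m = (ZMod.χ₈'.ringHomComp (Int.castRingHom ℂ)) m * cuspCoeff f' m)
    (hr : W.analyticRank = 1) (hrk : W.mordellWeilRank = 1) (hL' : W'.entireLFunction 1 ≠ 0)
    {H : Type} [Field H] [NumberField H] [Algebra K H] (hKH : Module.finrank K H = 2) {t : H}
    (htK : t ∉ Set.range (algebraMap K H)) (ht2 : t ^ 2 = algebraMap ℚ H (-2))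
    (G : Subgroup (H ≃ₐ[ℚ] H)) (χ : G →* ℂˣ) (s : G → ℤ) (hs : ∀ σ, ((χ σ : ℂˣ) : ℂ) = (s σ : ℂ))
    (τ : H ≃ₐ[ℚ] H) (hτG : τ ∈ G) (hsτ : s ⟨τ, hτG⟩ = -1)
    (hτK : ∀ a : K, τ (algebraMap K H a) = algebraMap K H a) (hτt : τ t = -t)
    {u : K} {e : ℚ} (hu : u ∉ Set.range (algebraMap ℚ K)) (hue : u ^ 2 = algebraMap ℚ K e)
    (c : K ≃ₐ[ℚ] K) (hcu : c u = -u)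
    [(V.quadraticTwist (-2)).IsElliptic] {C : VariableChange ℚ} (hC : C • W = V.quadraticTwist (-2))
    {P : (V.quadraticTwist (-2)).toAffine.Point}
    (hgen : ∀ R : (V.quadraticTwist (-2)).toAffine.Point,
      ∃ (k : ℤ) (T : (V.quadraticTwist (-2)).toAffine.Point), IsOfFinAddOrder T ∧ R = k • P + T)
    (htors : ∀ Q : ((V.quadraticTwist (-2)).quadraticTwist e).toAffine.Point, IsOfFinAddOrder Q)
    (DH : PAdicHeightDataK V 2 H)
    (hDH : ∀ (σ : G) (a b : (V.baseChange H).toAffine.Point),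
      DH.pairing (pointGalHom V H σ.1 a) (pointGalHom V H σ.1 b) = DH.pairing a b)
    {h₂ : ℚ_[2]}
    (hpin : DH.pairing
      (twistPointEquivOver V (not_mem_range_rat_of_not_mem_range htK) ht2
        (QuadraticDescent.incl H (V.quadraticTwist (-2)) P))
      (twistPointEquivOver V (not_mem_range_rat_of_not_mem_range htK) ht2
        (QuadraticDescent.incl H (V.quadraticTwist (-2)) P)) = h₂)
    (hGZ : ChiLineGrossZagierClauses ι K V H f (ι (((unitRoot V 2 : ℚ_[2]) : PadicAlgCl 2)))
      (baseChangeDirichlet K (ZMod.χ₈'.ringHomComp (Int.castRingHom ℂ))) 𝔭 𝔭' G χ DH)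
    (hh₂ : h₂ ≠ 0)
    -- the (Δ1′) descent law in `cm7`-currency (research stub of the road; an explicit hypothesis here)
    (s₂ : ℤ)
    (hΔ1 : (∑' k : ℕ, PowerSeries.coeff k (padicLFunctionTameBranch fE d.natAbs (unitRoot cm7 2 : ℚ_[2])
            ((χJ.ringHomComp (Int.castRingHom ℚ)).ringHomComp (Rat.castHom ℚ_[2])) 1) * (k : ℚ_[2]) * (-2) ^ (k - 1)).valuation - h₂.valuation =
      s₂ + (padicValNat 2 W.tamagawaProduct : ℤ) - 2 * (padicValNat 2 W.torsionOrder : ℤ) - 2) :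
    ∃ q : ℚ, shaAn W = (q : ℂ) ∧ q ≠ 0 ∧ padicValRat 2 q = s₂ := by
  obtain ⟨-, q, hq, hq0, hv⟩ := defectKey_chi8'_cm7_currency_neg ι K hGZ73 h2 hsplit 𝔭 𝔭' h𝔭 h𝔭' κ hκ hκ2 hd hM hfE
    hmodf hd0 hd4 hsq hcop h7 hχJ V V' hV hordV' hap hfV hfV' hV' h0 hmod W W' hg hg' hgε hg'ε hr hrk hL' hKH htK ht2 G χ s
    hs τ hτG hsτ hτK hτt hu hue c hcu hC hgen htors DH hDH hpin hGZ hh₂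
  exact ⟨q, hq, hq0, by linear_combination hv + hΔ1⟩

end Summit.BirchSwinnertonDyer.BirchSwinnertonDyer.Theorems.PrintCf2.DisegniPairTwo

end
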